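import Mathlib.Algebra.Category.Ring.Constructions
import Literature.RingTheory.GaloisAlgebras.GaloisDescentAlgebras
import Literature.AlgebraicGeometry.RelativeSpec.FiniteGroupQuotientGluing
import Literature.AlgebraicGeometry.Motives.JacobianGaloisDescent
import HarnessLib

/-!
# Galois descent of schemes: a semilinear `Gal(L/k)`-action on an `L`-scheme descends it to `k`
# (Weil; Görtz–Wedhorn I, Thm. 14.83 / Cor. 14.85; Serre, *Local Fields*, X §2; Milne,
# *Jacobian Varieties*, 1.9)

Let `L / k` be a finite Galois extension, `G = Gal(L/k) = L ≃ₐ[k] L`, and let `X` be a scheme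
with structure map `p : X → Spec L`, hence `r = p ≫ (Spec L → Spec k) : X → Spec k`. A
**semilinear Galois action** is an action `ρ` of `G` on `X` over `Spec k`
(`RelativeSpec.ActionOver r G`) covering the Galois action on `Spec L`:
`ρ σ ≫ p = p ≫ Spec(σ⁻¹)` — the convention of `GaloisDescent.gal` (`Motives/JacobianGaloisDescent`),
for which the base change `Y ×_k Spec L` of a `k`-scheme carries the action `1 × Spec(σ⁻¹)`.
Görtz–Wedhorn I, Thm. 14.83: for `L / k` finite Galois, base change `Y ↦ Y_L` is an equivalence
between quasi-projective `k`-schemes and quasi-projective `L`-schemes with a Galois descent datum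
(equivalently, Cor. 14.85, a semilinear `G`-action); the quasi-inverse is the quotient
`X ↦ X/G` (Mumford, *Abelian Varieties*, §7, Thm. p. 66; SGA 1, V.1.8), which exists as soon as
every `G`-orbit lies in an affine open. This is the descent step of Milne, *Jacobian Varieties*,
1.9 ("in constructing `J` we are allowed to make a finite separable extension of `k`").

This file proves the **essential surjectivity** half in the form needed there:

* `isPullback_affine` — the affine case: for `O` affine over `k` with a semilinear `G`-action, the
  square `O → Spec L`, `O → O/G`, over `Spec k` is cartesian. On rings this is Galois descent for
  algebras, `L ⊗_k Γ(O)^G ≅ Γ(O)` (`GaloisDescentAlgebras.isPushout_of_invariants`, Speiser's lemma,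
  with `Γ(O/G) = Γ(O)^G` by `ActionOver.range_app_toQuotient`), and `Spec` turns pushouts of rings
  into pullbacks (Mathlib `isPullback_SpecMap_of_isPushout`).
* `isPullback_glued` — the general case: for `X` separated over `k`, every point in a `G`-stable
  affine open (`hcov`), and the glued quotient `π : X → X/G` (`ActionOver.glued`,
  `Motives`-independent, `RelativeSpec/FiniteGroupQuotientGluing`), the square `X → Spec L`,
  `π : X → X/G`, over `Spec k` is **cartesian** (cartesian-ness is local on `X/G`, Mathlib
  `Scheme.isPullback_of_openCover`, and the chart squares are `isPullback_affine` transported along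
  `O ≅ X ×_{X/G} O/G`, `ActionOver.isPullback_chart`).
* `descended ρ : SchemeOver k` (`X₀ = X/G → Spec k`), `isoBaseChange : X ≅ X₀ ×_k Spec L`
  (over `Spec L`: `isoBaseChange_hom_snd`, `isoBaseChangeOver`), which is **`G`-equivariant** for
  `GaloisDescent.gal` on the right (`aut_hom_isoBaseChange_hom`).
* `exists_stableAffineOpen_of_orbit`, `forall_exists_stableAffineOpen` — the covering hypothesis
  `hcov` from "every finite set of points lies in an affine open" (quasi-projective schemes; Milne,
  proof of Prop. 3.2), for `X` separated: `⋂_g g⁻¹U` is a stable affine open (Mathlib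
  `IsAffineOpen.inf`).

Everything is proved; no named facts (D-0026). The group-structure half (descending a
`G`-equivariant group law on `X` to `X₀`, by `GaloisDescent.descentOver`) is left to the user of
this file.

Mathlib searched (pin): `isPullback_SpecMap_of_isPushout`, `CommRingCat.isPushout_of_isPushout`,
`Scheme.isPullback_of_openCover`, `Scheme.IsLocallyDirected.openCover`, `IsPullback.of_iso'`,
`IsAffineOpen.inf`, `Scheme.toSpecΓ_naturality`, `Scheme.ΓSpecIso_inv_naturality` (all used);
Mathlib has fpqc descent of *morphisms* and of some *properties* (`Morphisms/FlatDescent`) but no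
effective descent of schemes / Galois descent of objects.

## References

* U. Görtz, T. Wedhorn, *Algebraic Geometry I: Schemes*, 2nd ed., Springer Spektrum (2020):
  §(14.20)–(14.21), Thm. 14.83, Cor. 14.85 (Galois descent of quasi-projective schemes). [GortzWedhorn2020]
* J.-P. Serre, *Local Fields*, GTM 67 (1979), Ch. X, §2, Lemma 1 (descent of vector spaces). [SerreLocalFields1979]
* J. S. Milne, *Jacobian Varieties*, in *Arithmetic Geometry* (1986), §1, 1.9 and §3, proof of
  Prop. 3.2. [Milne1986JacobianVarieties]
* D. Mumford, *Abelian Varieties* (1970), §7, Thm. p. 66. [MumfordAV1970]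
-/

noncomputable section

open CategoryTheory CategoryTheory.Limits AlgebraicGeometry TopologicalSpace Opposite
open Literature.AlgebraicGeometry.RelativeSpec
open Literature.RingTheory.GaloisAlgebras Literature.RingTheory.GaloisAlgebras.GaloisDescentAlgebras

universe u

namespace Literature.AlgebraicGeometry.Motives

namespace GaloisDescentScheme

open AbelianVariety (bcSpec specAut specAut_mul specAut_one specAut_comp_bcSpec)

set_option backward.isDefEq.respectTransparency false

variable {k : Type u} [Field k] (L : Type u) [Field L] [Algebra k L]

/-- For a morphism `f : X ⟶ Spec R`, the ring map `R → Γ(X, ⊤)` it induces on global sections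
(`f♯` composed with `Γ(Spec R, ⊤) ≅ R`). [folklore] -/
def toΓ {X : Scheme.{u}} {R : CommRingCat.{u}} (f : X ⟶ Spec R) : R →+* Γ(X, ⊤) :=
  f.appTop.hom.comp (Scheme.ΓSpecIso R).inv.hom

/-- `X → Spec Γ(X, ⊤) → Spec R`, the second map being `Spec` of `toΓ f`, is `f` (the unit of the
`Γ ⊣ Spec` adjunction). [folklore] -/
@[reassoc]
theorem toSpecΓ_SpecMap_toΓ {X : Scheme.{u}} {R : CommRingCat.{u}} (f : X ⟶ Spec R) :
    X.toSpecΓ ≫ Spec.map (CommRingCat.ofHom (toΓ f)) = f := by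
  have h : CommRingCat.ofHom (toΓ f) = (Scheme.ΓSpecIso R).inv ≫ f.appTop := rfl
  rw [h, Spec.map_comp, ← Scheme.toSpecΓ_naturality_assoc, toSpecΓ_SpecMap_ΓSpecIso_inv,
    Category.comp_id]

/-- `toΓ (f ≫ Spec.map φ) = toΓ f ∘ φ`. [folklore] -/
theorem toΓ_comp_SpecMap {X : Scheme.{u}} {R S : CommRingCat.{u}} (f : X ⟶ Spec S) (φ : R ⟶ S) :
    toΓ (f ≫ Spec.map φ) = (toΓ f).comp φ.hom := by
  ext r
  change (f ≫ Spec.map φ).appTop ((Scheme.ΓSpecIso R).inv r) = f.appTop ((Scheme.ΓSpecIso S).inv (φ r))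
  rw [Scheme.Hom.comp_appTop, CommRingCat.comp_apply, ← CommRingCat.comp_apply _ (Spec.map φ).appTop,
    ← Scheme.ΓSpecIso_inv_naturality, CommRingCat.comp_apply]

/-- `toΓ (g ≫ f) = g♯ ∘ toΓ f`. [folklore] -/
theorem toΓ_comp {X Y : Scheme.{u}} {R : CommRingCat.{u}} (g : X ⟶ Y) (f : Y ⟶ Spec R) :
    toΓ (g ≫ f) = g.appTop.hom.comp (toΓ f) := by
  ext r
  change (g ≫ f).appTop ((Scheme.ΓSpecIso R).inv r) = g.appTop (f.appTop ((Scheme.ΓSpecIso R).inv r))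
  rw [Scheme.Hom.comp_appTop, CommRingCat.comp_apply]

/-! ## The affine case (Speiser) -/

section AffineChart

variable {O : Scheme.{u}} {r : O ⟶ Spec (.of k)} (p : O ⟶ Spec (.of L))
  (ρ : ActionOver r (L ≃ₐ[k] L)) (hr : r = p ≫ bcSpec k L)
  (hρ : ∀ σ : L ≃ₐ[k] L, (ρ.aut σ).hom ≫ p = p ≫ specAut L σ⁻¹)

/-- **The Galois action on global sections**: `σ` acts on `Γ(O, ⊤)` by pull-back along `σ⁻¹`
(a left action; the formula of `ActionOver.act` / `ActionOver.actQ` on the whole of `O`). [folklore] -/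
def actTop (σ : L ≃ₐ[k] L) : Γ(O, ⊤) →+* Γ(O, ⊤) := (ρ.aut σ⁻¹).hom.appTop.hom

/-- `actTop 1 = id`. [folklore] -/
theorem actTop_one : actTop L ρ 1 = RingHom.id _ := by
  have h1 : (ρ.aut (1 : L ≃ₐ[k] L)⁻¹).hom = 𝟙 O := by rw [inv_one, map_one]; rfl
  unfold actTop
  rw [h1, Scheme.Hom.id_appTop]
  rfl

/-- `actTop (σ τ) = actTop σ ∘ actTop τ`. [folklore] -/
theorem actTop_mul (σ τ : L ≃ₐ[k] L) : actTop L ρ (σ * τ) = (actTop L ρ σ).comp (actTop L ρ τ) := by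
  have h : (ρ.aut (σ * τ)⁻¹).hom = (ρ.aut σ⁻¹).hom ≫ (ρ.aut τ⁻¹).hom := by
    rw [mul_inv_rev, map_mul, Aut.Aut_mul_def]; rfl
  unfold actTop
  rw [h, Scheme.Hom.comp_appTop]
  rfl

/-- The Galois action on `Γ(O, ⊤)` as a homomorphism `Gal(L/k) → End Γ(O, ⊤)`. [folklore] -/
def actTopHom : (L ≃ₐ[k] L) →* (Γ(O, ⊤) →+* Γ(O, ⊤)) where
  toFun := actTop L ρ
  map_one' := actTop_one L ρ
  map_mul' := actTop_mul L ρ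

/-- Unfolding `actTopHom`. [folklore] -/
@[simp]
theorem actTopHom_apply (σ : L ≃ₐ[k] L) (s : Γ(O, ⊤)) :
    actTopHom L ρ σ s = (ρ.aut σ⁻¹).hom.appTop s := rfl

variable [Finite (L ≃ₐ[k] L)] [IsAffineHom r]

/-- `ActionOver.actQ σ ⊤` is `actTop σ` (the open `π⁻¹(⊤) = ⊤`). [folklore] -/
theorem actQ_top_apply (σ : L ≃ₐ[k] L) (s : Γ(O, ⊤)) :
    ρ.actQ σ ⊤ s = (ρ.aut σ⁻¹).hom.appTop s := by
  rw [ActionOver.actQ_apply]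
  simp only [Scheme.Hom.appLE, CommRingCat.comp_apply]
  have h : (homOfLE (ρ.aut_preimage_toQuotient_preimage σ⁻¹ ⊤).ge) = 𝟙 _ := Subsingleton.elim _ _
  rw [h, op_id]
  erw [CategoryTheory.Functor.map_id]
  rfl

end AffineChart

section AffineChartGalois

variable {O : Scheme.{u}} {r : O ⟶ Spec (.of k)} (p : O ⟶ Spec (.of L))
  (ρ : ActionOver r (L ≃ₐ[k] L)) (hr : r = p ≫ bcSpec k L)
  (hρ : ∀ σ : L ≃ₐ[k] L, (ρ.aut σ).hom ≫ p = p ≫ specAut L σ⁻¹)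
include hρ in
/-- **The Galois action on `Γ(O, ⊤)` is semilinear** over `L → Γ(O, ⊤)`: pulling back the
function `l ∘ p` along `σ⁻¹` gives `σ(l) ∘ p`, because `σ⁻¹ ≫ p = p ≫ Spec(σ)`. [folklore] -/
theorem isSemilinear_actTopHom :
    letI : Algebra L Γ(O, ⊤) := (toΓ p).toAlgebra
    IsSemilinear (actTopHom L ρ) := by
  letI : Algebra L Γ(O, ⊤) := (toΓ p).toAlgebra
  refine ⟨fun σ l ↦ ?_⟩
  change (ρ.aut σ⁻¹).hom.appTop (p.appTop ((Scheme.ΓSpecIso (.of L)).inv l)) =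
    p.appTop ((Scheme.ΓSpecIso (.of L)).inv (σ l))
  rw [← CommRingCat.comp_apply, ← Scheme.Hom.comp_appTop, hρ σ⁻¹, inv_inv, Scheme.Hom.comp_appTop,
    CommRingCat.comp_apply]
  congr 1
  rw [← CommRingCat.comp_apply, ← Scheme.ΓSpecIso_inv_naturality, CommRingCat.comp_apply]
  rfl

variable [FiniteDimensional k L] [IsGalois k L] [IsAffineHom r]

include hr hρ in
/-- **The affine case of Galois descent** (Görtz–Wedhorn I, Thm. 14.83 / Cor. 14.85; Serre,
*Local Fields*, X §2 Lemma 1): for `O` affine over `k` with a semilinear action of `Gal(L/k)`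
covering `Spec σ⁻¹` on `Spec L`, the square `O → Spec L`, `O → O/Gal`, over `Spec k`, is
**cartesian**: `O ≅ (O/Gal) ×_k Spec L`. Proof: on rings it is `L ⊗_k Γ(O)^{Gal} ≅ Γ(O)`
(`GaloisDescentAlgebras.isPushout_of_invariants`, with `Γ(O/Gal) = Γ(O)^{Gal}` by
`ActionOver.range_app_toQuotient`), and `Spec` turns pushouts of rings into pullbacks.
[cite: GortzWedhorn2020, Thm. 14.83 and Cor. 14.85] [cite: SerreLocalFields1979, Ch. X, §2, Lemma 1] -/
theorem isPullback_affine : IsPullback p ρ.toQuotient (bcSpec k L) ρ.quotientToBase := by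
  haveI : IsAffine O := isAffine_of_isAffineHom r
  haveI : IsAffine ρ.quotient := isAffine_of_isAffineHom ρ.quotientToBase
  -- the four algebra structures
  letI iLA : Algebra L Γ(O, ⊤) := (toΓ p).toAlgebra
  letI ikA : Algebra k Γ(O, ⊤) := ((toΓ p).comp (algebraMap k L)).toAlgebra
  haveI : IsScalarTower k L Γ(O, ⊤) := IsScalarTower.of_algebraMap_eq' rfl
  letI ikB : Algebra k Γ(ρ.quotient, ⊤) := (toΓ ρ.quotientToBase).toAlgebra
  letI iBA : Algebra Γ(ρ.quotient, ⊤) Γ(O, ⊤) := ρ.toQuotient.appTop.hom.toAlgebra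
  haveI : IsScalarTower k Γ(ρ.quotient, ⊤) Γ(O, ⊤) := by
    refine IsScalarTower.of_algebraMap_eq' ?_
    change (toΓ p).comp (algebraMap k L) = ρ.toQuotient.appTop.hom.comp (toΓ ρ.quotientToBase)
    rw [← toΓ_comp, ρ.toQuotient_quotientToBase, hr, toΓ_comp_SpecMap]
    rfl
  -- Speiser
  have hτ : IsSemilinear (actTopHom L ρ) := isSemilinear_actTopHom L p ρ hρ
  have hinj : Function.Injective (algebraMap Γ(ρ.quotient, ⊤) Γ(O, ⊤)) :=
    ρ.app_toQuotient_injective ⊤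
  have hrange : Set.range (algebraMap Γ(ρ.quotient, ⊤) Γ(O, ⊤)) =
      {a | ∀ σ, actTopHom L ρ σ a = a} := by
    have h := ρ.range_app_toQuotient ⊤
    ext a
    constructor
    · rintro ⟨b, rfl⟩ σ
      have hb : ρ.toQuotient.app ⊤ b ∈ Set.range (ρ.toQuotient.app ⊤) := ⟨b, rfl⟩
      rw [h] at hb
      have := hb σ
      rw [actQ_top_apply L ρ] at this
      exact this
    · intro ha
      have ha' : a ∈ {s | ∀ g : L ≃ₐ[k] L, ρ.actQ g ⊤ s = s} := fun g ↦ by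
        rw [actQ_top_apply L ρ]; exact ha g
      rw [← h] at ha'
      exact ha'
  have hP : Algebra.IsPushout k L Γ(ρ.quotient, ⊤) Γ(O, ⊤) :=
    isPushout_of_invariants hτ hinj hrange
  have hC := CommRingCat.isPushout_of_isPushout k L Γ(ρ.quotient, ⊤) Γ(O, ⊤)
  have hS := isPullback_SpecMap_of_isPushout _ _ _ _ hC
  -- transport along `O ≅ Spec Γ(O, ⊤)`, `O/Gal ≅ Spec Γ(O/Gal, ⊤)`
  refine hS.of_iso' O.isoSpec (Iso.refl _) ρ.quotient.isoSpec (Iso.refl _) ?_ ?_ ?_ ?_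
  · rw [Iso.refl_hom, Category.comp_id]
    exact toSpecΓ_SpecMap_toΓ p
  · change O.toSpecΓ ≫ Spec.map (CommRingCat.ofHom ρ.toQuotient.appTop.hom) =
      ρ.toQuotient ≫ ρ.quotient.toSpecΓ
    rw [CommRingCat.ofHom_hom, Scheme.toSpecΓ_naturality]
  · rw [Iso.refl_hom, Iso.refl_hom, Category.id_comp, Category.comp_id]
  · rw [Iso.refl_hom, Category.comp_id]
    exact toSpecΓ_SpecMap_toΓ ρ.quotientToBase

end AffineChartGalois

end GaloisDescentScheme

end Literature.AlgebraicGeometry.Motives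


/-! ## The general case: gluing the chart squares over `X/G` -/

namespace Literature.AlgebraicGeometry.Motives

namespace GaloisDescentScheme

open AbelianVariety (bcSpec specAut specAut_mul specAut_one specAut_comp_bcSpec bcFunctor)

variable {k : Type u} [Field k] (L : Type u) [Field L] [Algebra k L]

/-- Composition of the action automorphisms: `g ≫ h = aut (h * g)` on underlying morphisms. [folklore] -/
theorem _root_.Literature.AlgebraicGeometry.RelativeSpec.ActionOver.aut_hom_comp_aut_hom
    {X Y : Scheme.{u}} {r : X ⟶ Y} {G : Type*} [Group G] (ρ : ActionOver r G) (g h : G) :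
    (ρ.aut g).hom ≫ (ρ.aut h).hom = (ρ.aut (h * g)).hom := by
  rw [map_mul, Aut.Aut_mul_def]; rfl

section Glue

variable {X : Scheme.{u}} {r : X ⟶ Spec (.of k)} (p : X ⟶ Spec (.of L))
  (ρ : ActionOver r (L ≃ₐ[k] L)) (hr : r = p ≫ bcSpec k L)
  (hρ : ∀ σ : L ≃ₐ[k] L, (ρ.aut σ).hom ≫ p = p ≫ specAut L σ⁻¹)

include hρ in
/-- The restricted action on a stable open is again semilinear over `O → X → Spec L`. [folklore] -/
theorem restrict_semilinear (O : X.Opens) (hO : ∀ g : L ≃ₐ[k] L, (ρ.aut g).hom ⁻¹ᵁ O = O)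
    (σ : L ≃ₐ[k] L) :
    ((ρ.restrict O hO).aut σ).hom ≫ (O.ι ≫ p) = (O.ι ≫ p) ≫ specAut L σ⁻¹ := by
  rw [ActionOver.restrict_aut_hom, ← Category.assoc, ActionOver.restrictHom_ι, Category.assoc, hρ σ,
    Category.assoc]

variable [FiniteDimensional k L] [IsSeparated r]

/-- **The structure map `X/Gal → Spec k`** of the quotient of `X` by the Galois action (the
invariant morphism `r : X → Spec k` descended to the glued quotient). [folklore] -/
def quotToBase : ρ.glued ⟶ Spec (.of k) := ρ.gluedDesc r ρ.aut_comp

/-- On a chart `O/Gal ↪ X/Gal`, the structure map is that of the affine quotient `O/Gal`. [folklore] -/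
@[reassoc]
theorem gluedι_quotToBase (O : ρ.StableAffineOpens) :
    ρ.gluedι O ≫ quotToBase L ρ = (ρ.restrict O.1 O.2.1).quotientToBase := by
  apply ρ.pieceQuot_hom_ext O
  rw [quotToBase, ρ.gluedι_gluedDesc, ActionOver.pieceMk_localDesc]
  exact ((ρ.restrict O.1 O.2.1).toQuotient_quotientToBase).symm

/-- **The descended `k`-scheme `X₀ = X/Gal → Spec k`.** [cite: GortzWedhorn2020, Thm. 14.83] -/
def descended : SchemeOver k := Over.mk (quotToBase L ρ)

/-- The underlying scheme of `X₀` is the glued quotient (by `rfl`). [folklore] -/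
theorem descended_left : (descended L ρ).left = ρ.glued := rfl

/-- The structure map of `X₀` (by `rfl`). [folklore] -/
theorem descended_hom : (descended L ρ).hom = quotToBase L ρ := rfl

variable [IsGalois k L]

include hr hρ in
/-- The chart square `O → Spec L`, `O → O/Gal`, over `Spec k`, is cartesian (`isPullback_affine`
for the restricted action). [cite: GortzWedhorn2020, Thm. 14.83 and Cor. 14.85] -/
theorem isPullback_piece (O : ρ.StableAffineOpens) :
    IsPullback (O.1.ι ≫ p) (ρ.pieceMk O) (bcSpec k L) (ρ.restrict O.1 O.2.1).quotientToBase :=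
  isPullback_affine L (O.1.ι ≫ p) (ρ.restrict O.1 O.2.1) (by rw [Category.assoc, ← hr])
    (restrict_semilinear L p ρ hρ O.1 O.2.1)

variable (hcov : ∀ x : X, ∃ O : ρ.StableAffineOpens, x ∈ O.1)

include hr hρ in
/-- **Galois descent of a scheme with a semilinear action (Weil; Görtz–Wedhorn I, Thm. 14.83,
Cor. 14.85; Serre, *Local Fields*, X §2 / *Algebraic Groups and Class Fields*, V §20).** Let
`L / k` be finite Galois and let `Gal(L/k)` act on the `L`-scheme `X`, separated over `k`, by
`k`-automorphisms covering `Spec σ⁻¹` on `Spec L`, every point lying in a `Gal`-stable affine open.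
Then for the glued quotient `π : X → X/Gal` (Mumford §7; `ActionOver.glued`) the square
`X → Spec L`, `π : X → X/Gal`, over `Spec k`, is **cartesian**: `X ≅ (X/Gal) ×_k Spec L`, i.e. the
`k`-scheme `X/Gal` is a `k`-form of `X`. Proof: cartesian-ness is local on `X/Gal`
(Mathlib `Scheme.isPullback_of_openCover`), and over the chart `O/Gal` it is `isPullback_piece`
transported along `O ≅ X ×_{X/Gal} O/Gal` (`ActionOver.isPullback_chart`).
[cite: GortzWedhorn2020, Thm. 14.83 and Cor. 14.85] [cite: SerreLocalFields1979, Ch. X, §2, Lemma 1] -/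
theorem isPullback_glued :
    IsPullback (ρ.gluedMk hcov) p (quotToBase L ρ) (bcSpec k L) := by
  refine Scheme.isPullback_of_openCover _ _ _ _
    (Scheme.IsLocallyDirected.openCover ρ.glueFunctor) fun O ↦ ?_
  change IsPullback (pullback.snd (ρ.gluedMk hcov) (ρ.gluedι O))
    (pullback.fst (ρ.gluedMk hcov) (ρ.gluedι O) ≫ p) (ρ.gluedι O ≫ quotToBase L ρ) (bcSpec k L)
  have h1 := (isPullback_piece L p ρ hr hρ O).flip
  have hc := (ρ.isPullback_chart hcov O).flip
  refine h1.of_iso hc.isoPullback (Iso.refl _) (Iso.refl _) (Iso.refl _) ?_ ?_ ?_ ?_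
  · rw [Iso.refl_hom, Category.comp_id, hc.isoPullback_hom_snd]
  · rw [Iso.refl_hom, Category.comp_id, hc.isoPullback_hom_fst_assoc]
  · rw [Iso.refl_hom, Iso.refl_hom, Category.comp_id, Category.id_comp, gluedι_quotToBase]
  · rw [Iso.refl_hom, Iso.refl_hom, Category.comp_id, Category.id_comp]

/-! ### The `k`-form `X₀ = X/G` and its equivariant identification `X ≅ X₀ ×_k Spec L` -/

include hr hρ in
/-- **`X ≅ X₀ ×_k Spec L`** as schemes (`isPullback_glued`). [cite: GortzWedhorn2020, Thm. 14.83 and Cor. 14.85] -/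
def isoBaseChange : X ≅ GaloisDescent.bc L (descended L ρ) :=
  (isPullback_glued L p ρ hr hρ hcov).isoPullback

/-- `X ≅ X₀ ×_k Spec L → X₀` is the quotient map `π`. [folklore] -/
@[reassoc (attr := simp)]
theorem isoBaseChange_hom_fst :
    (isoBaseChange L p ρ hr hρ hcov).hom ≫ pullback.fst _ _ = ρ.gluedMk hcov :=
  (isPullback_glued L p ρ hr hρ hcov).isoPullback_hom_fst

/-- `X ≅ X₀ ×_k Spec L → Spec L` is the structure map `p`: the isomorphism is one of
`L`-schemes. [folklore] -/
@[reassoc (attr := simp)]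
theorem isoBaseChange_hom_snd :
    (isoBaseChange L p ρ hr hρ hcov).hom ≫ pullback.snd _ _ = p :=
  (isPullback_glued L p ρ hr hρ hcov).isoPullback_hom_snd

/-- **The identification is Galois-equivariant**: it carries the given action `σ` on `X` to the
Galois automorphism `1 × Spec σ⁻¹` of `X₀ ×_k Spec L` (`GaloisDescent.gal`). [cite: GortzWedhorn2020, §(14.20) and Thm. 14.83] -/
theorem aut_hom_isoBaseChange_hom (σ : L ≃ₐ[k] L) :
    (ρ.aut σ).hom ≫ (isoBaseChange L p ρ hr hρ hcov).hom =
      (isoBaseChange L p ρ hr hρ hcov).hom ≫ GaloisDescent.gal L (descended L ρ) σ := by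
  apply pullback.hom_ext
  · rw [Category.assoc, Category.assoc, isoBaseChange_hom_fst, GaloisDescent.gal_fst,
      isoBaseChange_hom_fst]
    exact ρ.aut_hom_gluedMk hcov σ
  · rw [Category.assoc, Category.assoc, isoBaseChange_hom_snd, GaloisDescent.gal_snd,
      isoBaseChange_hom_snd_assoc, hρ]

/-- **`X ≅ (X₀)_L` as `L`-schemes**: the isomorphism `Over.mk p ≅ (bcFunctor k L).obj X₀` in
`SchemeOver L`. [cite: GortzWedhorn2020, Thm. 14.83 and Cor. 14.85] -/
def isoBaseChangeOver : Over.mk p ≅ (bcFunctor k L).obj (descended L ρ) :=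
  Over.isoMk (isoBaseChange L p ρ hr hρ hcov) (isoBaseChange_hom_snd L p ρ hr hρ hcov)

/-- The underlying scheme isomorphism of `isoBaseChangeOver` (by `rfl`). [folklore] -/
theorem isoBaseChangeOver_hom_left :
    (isoBaseChangeOver L p ρ hr hρ hcov).hom.left = (isoBaseChange L p ρ hr hρ hcov).hom := rfl

end Glue

/-! ## Stable affine neighbourhoods from "finite sets lie in affine opens" -/

section Orbits

variable {X : Scheme.{u}} {Y : Scheme.{u}} {r : X ⟶ Y} {G : Type*} [Group G] [Finite G]
  (ρ : ActionOver r G)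

omit [Finite G] in
/-- A nonempty finite intersection of affine opens of a separated scheme is affine (Mathlib
`IsAffineOpen.inf`, iterated). [folklore] -/
theorem isAffineOpen_finset_inf [X.IsSeparated] {ι : Type*} (s : Finset ι) (hs : s.Nonempty)
    (V : ι → X.Opens) (hV : ∀ i ∈ s, IsAffineOpen (V i)) : IsAffineOpen (s.inf V) := by
  classical
  induction hs using Finset.Nonempty.cons_induction with
  | singleton a => simpa using hV a (Finset.mem_singleton_self a)
  | cons a s ha hs ih =>
    rw [Finset.cons_eq_insert, Finset.inf_insert]
    exact (hV a (by simp)).inf (ih fun i hi ↦ hV i (by simp [hi]))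

/-- **Orbits in affine opens give stable affine neighbourhoods** (the reduction in Mumford, §7,
Thm. p. 66, and Milne, *Jacobian Varieties*, proof of Prop. 3.2: "any finite set of points of a
quasi-projective variety is contained in an open affine"): if `X` is separated, `Y` is affine and
the `G`-orbit of `x` lies in an affine open `U`, then `⋂_g g⁻¹U` is a `G`-stable affine open
neighbourhood of `x`, affine over `Y`. [cite: MumfordAV1970, §7 Thm. p. 66 (hypothesis)] [cite: Milne1986JacobianVarieties, §3, proof of Prop. 3.2] -/
theorem exists_stableAffineOpen_of_orbit [X.IsSeparated] [IsAffine Y] (x : X) (U : X.Opens)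
    (hU : IsAffineOpen U) (hx : ∀ g : G, (ρ.aut g).hom x ∈ U) :
    ∃ O : ρ.StableAffineOpens, x ∈ O.1 := by
  classical
  haveI : Fintype G := Fintype.ofFinite G
  let V : G → X.Opens := fun g ↦ (ρ.aut g).hom ⁻¹ᵁ U
  let O : X.Opens := Finset.univ.inf V
  have hmem : ∀ y : X, y ∈ O ↔ ∀ g : G, (ρ.aut g).hom y ∈ U := fun y ↦ by
    -- membership in a finite intersection of opens (cf. `mem_finset_inf_opens_iff` of
    -- `Motives/FormalFunctionsGrothendieckComplex`, not imported here)
    rw [← SetLike.mem_coe, TopologicalSpace.Opens.coe_finset_inf, Finset.inf_eq_iInf]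
    simp only [Function.comp_apply, Set.iInf_eq_iInter, Set.mem_iInter, SetLike.mem_coe,
      Finset.mem_univ, forall_const]
    rfl
  have hO : ∀ g : G, (ρ.aut g).hom ⁻¹ᵁ O = O := by
    intro g
    ext y
    change (ρ.aut g).hom y ∈ O ↔ y ∈ O
    rw [hmem, hmem]
    constructor
    · intro H h
      have := H (h * g⁻¹)
      rwa [← Scheme.Hom.comp_apply, ρ.aut_hom_comp_aut_hom, inv_mul_cancel_right] at this
    · intro H h
      rw [← Scheme.Hom.comp_apply, ρ.aut_hom_comp_aut_hom]
      exact H (h * g)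
  have hOaff : IsAffineOpen O :=
    isAffineOpen_finset_inf Finset.univ ⟨1, Finset.mem_univ _⟩ V
      fun g _ ↦ hU.preimage_of_isIso (ρ.aut g).hom
  haveI : IsAffine (O : Scheme.{u}) := hOaff
  exact ⟨⟨O, hO, inferInstance⟩, (hmem x).mpr hx⟩

/-- If every finite set of points of the separated scheme `X` lies in an affine open and `Y` is
affine, every point has a `G`-stable affine open neighbourhood, affine over `Y` (apply the previous
lemma to the orbit). [cite: MumfordAV1970, §7 Thm. p. 66 (hypothesis)] -/
theorem forall_exists_stableAffineOpen [X.IsSeparated] [IsAffine Y]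
    (hfin : ∀ S : Finset X, ∃ U : X.Opens, IsAffineOpen U ∧ (↑S : Set X) ⊆ U) (x : X) :
    ∃ O : ρ.StableAffineOpens, x ∈ O.1 := by
  classical
  haveI : Fintype G := Fintype.ofFinite G
  obtain ⟨U, hU, hS⟩ := hfin (Finset.univ.image fun g : G ↦ (ρ.aut g).hom x)
  refine exists_stableAffineOpen_of_orbit ρ x U hU fun g ↦ hS ?_
  simp only [Finset.coe_image, Finset.coe_univ, Set.image_univ, Set.mem_range]
  exact ⟨g, rfl⟩

end Orbits

end GaloisDescentScheme

end Literature.AlgebraicGeometry.Motives
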